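import Summits.ResolutionOfSingularities.ResolutionOfSingularities.Theses.Valuative
import Literature.AlgebraicGeometry.Resolution.LocalUniformization

/-!
# `Valuative.RankOneRel` (stmt-ResolutionOfSingularities-0644): rank-one reduction, relative form

Route `ResolutionOfSingularities/Valuative`, support item `RankOneRel`: if RELATIVE Zariski local
uniformization holds for every rank-one valuation ring (`Nonempty O.valuation.RankOne`) of every
finitely generated extension `K/k` with `char k = p`, then it holds for every valuation ring
(`LUrel_p`). This is Novacoski–Spivakovsky, *Reduction of local uniformization to the rank one
case* (arXiv:1204.4751), Thm. 1.1, for the category of local domains essentially of finite type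
over `k` — PROVED in the tree as
`Literature.AlgebraicGeometry.Resolution.NovacoskiSpivakovsky2014_holds`
(`RankOneReductionProofs.lean`). This file is the glue between the route's wording and the
fact's wording (`RelLocalUniformization`, which asks `Frac R = K` of the model `R` to dominate):

* fact hypothesis from the item hypothesis: a finitely generated `R ⊆ O'` with `Frac R = K'`
  makes `K'/k` finitely generated (`IntermediateField.fg_top_iff`, essentially-of-finite-type
  towers) and puts `k ⊆ O'`;
* item conclusion from the fact conclusion: a finitely generated `R ⊆ O` is first enlarged to
  `R ⊔ A₀` for an affine model `A₀ ⊆ O` of `K/k` (`exists_affineModel`: invert the field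
  generators not in `O`), so that `Frac (R ⊔ A₀) = K`; then `Frac A = K` for the uniformizing
  `A ⊇ R ⊔ A₀` (`isFractionRing_subalgebra_of_le`).

The prime `p` and `CharP k p` play no role (the reduction is characteristic-free).
-/

open Literature.AlgebraicGeometry.Resolution

-- `Summit.<Summit>.<Sub>.Theorems` with `Sub = Summit` (single-conjunct summit, D-0017): the duplicated
-- namespace component is the tree layout.
set_option linter.dupNamespace false

namespace Summit.ResolutionOfSingularities.ResolutionOfSingularities.Theorems

/-- The hypothesis of `NovacoskiSpivakovsky2014` over a base field `k` of characteristic `p`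
follows from the route's rank-one relative local uniformization in characteristic `p`: for a
finitely generated `k`-subalgebra `R ⊆ O'` of `K'` with `Frac R = K'`, the extension `K'/k` is
finitely generated and `k ⊆ O'`. [folklore] -/
theorem relLocalUniformization_rankOne_of_lurel {p : ℕ} {k : Type} [Field k] [CharP k p]
    (H : ∀ (k K : Type) [Field k] [CharP k p] [Field K] [Algebra k K],
      (⊤ : IntermediateField k K).FG → ∀ O : ValuationSubring K, (∀ c : k, algebraMap k K c ∈ O) →
      Nonempty O.valuation.RankOne → ∀ R : Subalgebra k K, R.FG → R.toSubring ≤ O.toSubring →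
      ∃ (A : Subalgebra k K) (h : A.toSubring ≤ O.toSubring), R ≤ A ∧ A.FG ∧ IsFractionRing A K ∧
        IsRegularLocalRing (Localization.AtPrime
          (Ideal.comap (Subring.inclusion h) (IsLocalRing.maximalIdeal O))))
    (K' : Type) [Field K'] [Algebra k K'] (O' : ValuationSubring K')
    (hr : Nonempty O'.valuation.RankOne) : RelLocalUniformization k K' O' := by
  intro R hRfg hRfr hRO
  haveI : Algebra.FiniteType k R := R.fg_iff_finiteType.mp hRfg
  haveI : Algebra.EssFiniteType R K' :=
    Algebra.EssFiniteType.of_isLocalization K' (nonZeroDivisors R)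
  have hKfg : (⊤ : IntermediateField k K').FG :=
    IntermediateField.fg_top_iff.mpr (Algebra.EssFiniteType.comp k R K')
  obtain ⟨A, h, hle, hAfg, -, hreg⟩ :=
    H k K' hKfg O' (fun c => hRO (R.algebraMap_mem c)) hr R hRfg hRO
  exact ⟨A, h, hle, hAfg, hreg⟩

/-- Every finitely generated `k`-subalgebra `R ⊆ O` of a finitely generated extension `K/k`
(`k ⊆ O`) is contained in a finitely generated `R' ⊆ O` with `Frac R' = K`: take `R' = R ⊔ A₀`
for an affine model `A₀ ⊆ O` (`exists_affineModel`). [folklore] -/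
theorem exists_fg_isFractionRing_between {k K : Type} [Field k] [Field K] [Algebra k K]
    (hKfg : (⊤ : IntermediateField k K).FG) (O : ValuationSubring K)
    (hkO : ∀ c : k, algebraMap k K c ∈ O) (R : Subalgebra k K) (hRfg : R.FG)
    (hRO : R.toSubring ≤ O.toSubring) :
    ∃ R' : Subalgebra k K, R ≤ R' ∧ R'.FG ∧ R'.toSubring ≤ O.toSubring ∧ IsFractionRing R' K := by
  obtain ⟨A₀, hA₀O, hA₀fg, hA₀fr⟩ := exists_affineModel k K hKfg O hkO
  let Oalg : Subalgebra k K := { O.toSubring with algebraMap_mem' := hkO }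
  have hRle : R ≤ Oalg := fun x hx => hRO hx
  have hA₀le : A₀ ≤ Oalg := fun x hx => hA₀O hx
  have hle : R ⊔ A₀ ≤ Oalg := sup_le hRle hA₀le
  haveI := hA₀fr
  exact ⟨R ⊔ A₀, le_sup_left, hRfg.sup hA₀fg, fun x hx => hle hx,
    isFractionRing_subalgebra_of_le A₀ (R ⊔ A₀) le_sup_right⟩

/-- **Settles `stmt-ResolutionOfSingularities-0644` (`Valuative.RankOneRel`).** Rank-one
reduction of relative local uniformization: if `LUrel` holds for all rank-one valuation rings of
finitely generated `K/k`, `char k = p`, then `LUrel_p`. Novacoski–Spivakovsky 2014, Thm. 1.1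
(`NovacoskiSpivakovsky2014_holds`) composed with the glue above: feed the fact's rank-one
hypothesis from the item's (`relLocalUniformization_rankOne_of_lurel`), enlarge the given `R` to a
model with fraction field `K` (`exists_fg_isFractionRing_between`), uniformize it, and read off
`Frac A = K` from `R' ≤ A` (`isFractionRing_subalgebra_of_le`).
[cite: NovacoskiSpivakovsky2014, Thm. 1.1] -/
theorem rankOneRel_proof :
    Summit.ResolutionOfSingularities.ResolutionOfSingularities.Theses.Valuative.RankOneRel := by
  unfold Theses.Valuative.RankOneRel
  intro p _hp H k K _ _ _ _ hKfg O hkO R hRfg hRO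
  have hNS : RelLocalUniformization k K O :=
    NovacoskiSpivakovsky2014_holds k (relLocalUniformization_rankOne_of_lurel H) K O
  obtain ⟨R', hRR', hR'fg, hR'O, hR'fr⟩ := exists_fg_isFractionRing_between hKfg O hkO R hRfg hRO
  obtain ⟨A, h, hle, hAfg, hreg⟩ := hNS R' hR'fg hR'fr hR'O
  haveI := hR'fr
  exact ⟨A, h, hRR'.trans hle, hAfg, isFractionRing_subalgebra_of_le R' A hle, hreg⟩

end Summit.ResolutionOfSingularities.ResolutionOfSingularities.Theorems
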